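import Summits.Ventures.YMGap.FlowData.SecondOrderTailBlocks

/-!
# Venture YMGap, track Y3 FLOW-DATA — the SECOND-ORDER TAIL («x2r») certificate of lineage C (engine-3), typed

HONEST FRAMING: venture file of the cell `pub-ymgap` (QuantumFields programme), track Y3.  Lineage C (engine-3,
kernels «sce-onesite2x» / «x2r», method note `engine/sce/results-Y3/onesite2/code-x2r/X2R-METHOD.md`, accepted by the
cell's flow referee as FR-156 on 2026-08-23) certifies the TOP eigenvalue `λ₀(M)` of a symmetry block
`M = S^{1/2} P̂ S^{1/2} ⪰ 0` of the one-site SU(2) Wilson transfer matrix from a KEPT SET of basis states (coordinate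
projection `1 − Q`; the dropped coordinates `Q` carry weights `≤ ε`, so `Q M Q ⪯ ε`) and a floating-point top vector `v`
of the kept block.  Besides the first-order tail `λ₀(M) ≤ λ₀(M_SS) + ε` (the typed `KWeightTail` theorem of lineage B)
the x2r certificate uses the sharper SECOND-ORDER bound

  (TB)  `λ₀(M) ≤ μ₀ + c₀ (1 + γ/(μ₀ − ℓ₁ − γ))`,  `γ = εΛ/(ℓ − ε)`,  `c₀ = (√X + √(εΛ)·η)²/(ℓ − ε)`,  `η = √2·r/(ρ − ℓ₁)`,

where `μ₀` is the top eigenvalue of the kept block with unit eigenvector `u₀`, `ℓ₁` bounds the kept block on `u₀^⊥`,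
`ε < ℓ ≤ λ₀(M)`, `Λ` bounds the kept block, `ρ = ⟨v, M v⟩ > ℓ₁`, `r = ‖(1 − Q) M v − ρ v‖`, `X = ‖Q M v‖²`
(X2R-METHOD.md §«The bounds»; FLOW-REFEREE.md FR-156).  This file is that chain as pure linear algebra on a real inner
product space `E` (no finite-dimensionality is needed: the top eigenvalue enters through an eigenvector):

* file 1/2 `SecondOrderTailBlocks` (imported): §1 `schur_tail` / `le_of_schur_tail` (the Schur-complement step
  `λ ‖a‖² ≤ ⟨a, M a⟩ + ‖Q (M a)‖²/(λ − ε)` for `a = x − Q x`, hence `λ ≤ λ_max(M_SS + M_S⊥ M_⊥S/(ℓ − ε))`), §2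
  `offblock_sq_le` (`‖Q (M a)‖² ≤ ε ⟨a, M a⟩` for `M ⪰ 0`), §3 `compression_bound` (the 2 × 2 compression along a unit
  eigenvector `u₀` of the kept block: `⟨a, (A + C) a⟩ ≤ (μ₀ + c + cγ/(μ₀ + c − μ₁ − γ)) ‖a‖²`);
* §4 `norm_sub_le_of_residual` — the top-eigenvector perturbation bound `‖u₀ − v‖ ≤ √2 · r/(ρ − ℓ₁)` (one-vector
  Davis–Kahan with the normalisation step) and `temple_upper` — Temple's bound `μ₀ ≤ ρ + r²/(ρ − ℓ₁)` in the same setting;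
* §5 `x2r_upper_bound` — the assembled certificate inequality (TB) with Temple's `μ₀ ≤ ρ + r²/(ρ − ℓ₁)` available for the
  `μ₀` outside the denominator, exactly the quantities `x2r_cert.py` evaluates (`c0`, `gam`, `eta`, `den`); and
  `rayleigh_corrected_lower` — the first-order-corrected Rayleigh lower bound (L2) `λ_max ≥ (ρ' + 2 cr)/(1 + ‖z‖²)` used for
  the lower endpoint.

No matrix, no number, no row, nothing about limits or a mass gap; the floating-point / interval part of a row (binary128
Chebyshev recurrence, Bessel enclosures, the Ostrowski–Weyl certificate producing `ℓ₁`, `μ₀ ∈ [μ₀_lo, μ₀_up]`) is NOT covered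
here — those enter as the real hypotheses of §5, as in the sibling files `KWeightTailTheorem` (lineage B) and
`RitzDeflationCertificate` (lineage A).  The tree already holds Temple / Kato–Temple for a Hilbert eigenbasis
(`Literature.Analysis.OperatorTheory.TempleInequality`, `KatoTempleInequality`) and the one-vector `sin θ` bound
(`Literature.Analysis.InnerProduct.DavisKahanSinTheta`); §4 re-derives the two special cases needed here from a top
eigenvector and a form bound on its orthocomplement only, which is the shape of the certificate's data.

References: Y. Saad, *Numerical Methods for Large Eigenvalue Problems* (1992), Ch. III §3.2, Thm 3.8 (Kato–Temple) and
Thm 3.9 (angle bound) [cite: Saad1992, Ch. III Thm 3.8; Thm 3.9]; R. A. Horn, C. R. Johnson, *Matrix Analysis*, 2nd ed.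
(2013), Thm 7.7.7 / (0.8.5) (Schur complement) [cite: HornJohnson2013, Thm 7.7.7]; the cell's X2R-METHOD.md and
FLOW-REFEREE.md FR-156 (2026-08-23).
-/

noncomputable section

open scoped InnerProductSpace
open RealInnerProductSpace

namespace Summit.Ventures.YMGap.FlowData

namespace SecondOrderTail

variable {E : Type*} [NormedAddCommGroup E] [InnerProductSpace ℝ E]

/-! ### §4 The top eigenvector from an approximate one: Temple's bound and `‖u₀ − v‖ ≤ √2 · r/(ρ − ℓ₁)` -/

section TopVector

variable {A : E →ₗ[ℝ] E} (hAs : ∀ x y : E, ⟪A x, y⟫ = ⟪x, A y⟫)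
include hAs

/-- Decomposition of a unit vector `v` along a unit eigenvector `u₀` (`A u₀ = μ₀ u₀`, `A ⪯ ℓ₁` on `u₀^⊥`, `ℓ₁ < ρ = ⟨v, A v⟩`):
with `α = ⟨u₀, v⟩`, `y = v − α u₀`, `R = ‖A y − ρ y‖`, `r = ‖A v − ρ v‖` one has `α² + ‖y‖² = 1`, `ρ = α² μ₀ + ⟨y, A y⟩`,
`r² = α² (μ₀ − ρ)² + R²`, `(ρ ‖y‖² − ⟨y, A y⟩)² ≤ ‖y‖² R²` (Cauchy–Schwarz) and `⟨y, A y⟩ ≤ ℓ₁ ‖y‖²`. [folklore] -/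
theorem top_decomp {u₀ v : E} (hu : ‖u₀‖ = 1) (hv : ‖v‖ = 1) {μ₀ ℓ₁ : ℝ} (hAu : A u₀ = μ₀ • u₀)
    (hℓ₁ : ∀ y : E, ⟪u₀, y⟫ = 0 → ⟪y, A y⟫ ≤ ℓ₁ * ‖y‖ ^ 2) (hρ : ℓ₁ < ⟪v, A v⟫) {α : ℝ} {y : E}
    (hα : α = ⟪u₀, v⟫) (hy : y = v - α • u₀) :
    α ^ 2 + ‖y‖ ^ 2 = 1 ∧ ⟪v, A v⟫ = α ^ 2 * μ₀ + ⟪y, A y⟫ ∧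
      ‖A v - ⟪v, A v⟫ • v‖ ^ 2 = α ^ 2 * (μ₀ - ⟪v, A v⟫) ^ 2 + ‖A y - ⟪v, A v⟫ • y‖ ^ 2 ∧
      (⟪v, A v⟫ * ‖y‖ ^ 2 - ⟪y, A y⟫) ^ 2 ≤ ‖y‖ ^ 2 * ‖A y - ⟪v, A v⟫ • y‖ ^ 2 ∧ ⟪y, A y⟫ ≤ ℓ₁ * ‖y‖ ^ 2 := by
  obtain ⟨hy0, hnorm⟩ := norm_sq_eq_along_unit hu v
  rw [← hα, ← hy] at hy0 hnorm
  rw [hv, one_pow] at hnorm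
  set ρ := ⟪v, A v⟫ with hρdef
  have huu : ⟪u₀, u₀⟫ = 1 := by rw [real_inner_self_eq_norm_sq, hu, one_pow]
  have hyu : ⟪y, u₀⟫ = 0 := by rw [real_inner_comm]; exact hy0
  have e : v = α • u₀ + y := by rw [hy]; abel
  have hAy0 : ⟪u₀, A y⟫ = 0 := by rw [← hAs, hAu, real_inner_smul_left, hy0, mul_zero]
  -- ρ = α² μ₀ + ⟨y, A y⟩
  have hE1 : ρ = α ^ 2 * μ₀ + ⟪y, A y⟫ := by
    rw [hρdef, e, map_add, map_smul, hAu, inner_add_left, inner_add_right, inner_add_right, real_inner_smul_left,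
      real_inner_smul_left, real_inner_smul_right, real_inner_smul_right, huu, hAy0, smul_smul, real_inner_smul_right,
      hyu]
    ring
  -- r² = α²(μ₀ − ρ)² + R²
  have hres : A v - ρ • v = (α * (μ₀ - ρ)) • u₀ + (A y - ρ • y) := by
    rw [e, map_add, map_smul, hAu, smul_add, smul_smul, smul_smul]
    module
  have horth : ⟪(α * (μ₀ - ρ)) • u₀, A y - ρ • y⟫ = 0 := by
    rw [real_inner_smul_left, inner_sub_right, hAy0, real_inner_smul_right, hy0, mul_zero, sub_zero, mul_zero]
  have hE3 : ‖A v - ρ • v‖ ^ 2 = α ^ 2 * (μ₀ - ρ) ^ 2 + ‖A y - ρ • y‖ ^ 2 := by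
    rw [hres, norm_add_sq_real, horth, mul_zero, add_zero, norm_smul, mul_pow, hu, one_pow, mul_one,
      Real.norm_eq_abs, sq_abs, mul_pow]
  -- (ρ − ℓ₁)² ‖y‖² ≤ R²
  have hYb : ⟪y, A y⟫ ≤ ℓ₁ * ‖y‖ ^ 2 := hℓ₁ y hy0
  have hform : ⟪y, ρ • y - A y⟫ = ρ * ‖y‖ ^ 2 - ⟪y, A y⟫ := by
    rw [inner_sub_right, real_inner_smul_right, real_inner_self_eq_norm_sq]
  have hcs : ⟪y, ρ • y - A y⟫ ≤ ‖y‖ * ‖A y - ρ • y‖ := by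
    have h := real_inner_le_norm y (ρ • y - A y)
    rwa [← norm_neg (ρ • y - A y), neg_sub] at h
  have hρℓ : 0 < ρ - ℓ₁ := sub_pos.mpr hρ
  have hW0 : (ρ - ℓ₁) * ‖y‖ ^ 2 ≤ ρ * ‖y‖ ^ 2 - ⟪y, A y⟫ := by linarith [hYb]
  have hWnn : 0 ≤ ρ * ‖y‖ ^ 2 - ⟪y, A y⟫ := le_trans (mul_nonneg hρℓ.le (sq_nonneg _)) hW0
  have hWle : ρ * ‖y‖ ^ 2 - ⟪y, A y⟫ ≤ ‖y‖ * ‖A y - ρ • y‖ := by rw [← hform]; exact hcs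
  have hE4 : (ρ * ‖y‖ ^ 2 - ⟪y, A y⟫) ^ 2 ≤ ‖y‖ ^ 2 * ‖A y - ρ • y‖ ^ 2 := by
    have h := mul_self_le_mul_self hWnn hWle
    nlinarith [h]
  exact ⟨hnorm.symm, hE1, hE3, hE4, hYb⟩

/-- **Temple's upper bound for the top eigenvalue** from an approximate eigenvector.  `A` symmetric, `u₀` a unit
eigenvector with `A u₀ = μ₀ u₀` and `⟨y, A y⟩ ≤ ℓ₁ ‖y‖²` on `u₀^⊥` (so `ℓ₁` bounds the rest of the spectrum); `v` a unit
vector with Rayleigh quotient `ρ = ⟨v, A v⟩ > ℓ₁` and residual `r = ‖A v − ρ v‖`.  Then `ρ ≤ μ₀ ≤ ρ + r²/(ρ − ℓ₁)`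
(Kato 1949; Saad Thm 3.8 with `(a, b) = (ℓ₁, ∞)`; the tree's `kato_temple_enclosure` is the Hilbert-eigenbasis form).
[cite: Saad1992, Ch. III Thm 3.8] -/
theorem temple_upper {u₀ v : E} (hu : ‖u₀‖ = 1) (hv : ‖v‖ = 1) {μ₀ ℓ₁ : ℝ} (hAu : A u₀ = μ₀ • u₀)
    (hℓ₁ : ∀ y : E, ⟪u₀, y⟫ = 0 → ⟪y, A y⟫ ≤ ℓ₁ * ‖y‖ ^ 2) (hρ : ℓ₁ < ⟪v, A v⟫) :
    ⟪v, A v⟫ ≤ μ₀ ∧ μ₀ ≤ ⟪v, A v⟫ + ‖A v - ⟪v, A v⟫ • v‖ ^ 2 / (⟪v, A v⟫ - ℓ₁) := by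
  obtain ⟨hE2, hE1, hE3, hE4, hE5⟩ := top_decomp hAs hu hv hAu hℓ₁ hρ rfl rfl
  set ρ := ⟪v, A v⟫
  set α := ⟪u₀, v⟫
  set y := v - α • u₀
  set Y := ⟪y, A y⟫
  set R := ‖A y - ρ • y‖
  set r := ‖A v - ρ • v‖
  have hρℓ : 0 < ρ - ℓ₁ := sub_pos.mpr hρ
  have ht0 : 0 ≤ ‖y‖ ^ 2 := sq_nonneg _
  have hα0 : 0 ≤ α ^ 2 := sq_nonneg _
  -- D := μ₀ − ρ satisfies D α² = ρ ‖y‖² − Y ≥ (ρ − ℓ₁) ‖y‖² ≥ 0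
  have hD : (μ₀ - ρ) * α ^ 2 = ρ * ‖y‖ ^ 2 - Y := by
    have h1 : ρ = ρ * (α ^ 2 + ‖y‖ ^ 2) := by rw [hE2, mul_one]
    linear_combination (-1 : ℝ) * hE1 + h1
  have hG1 : (ρ - ℓ₁) * ‖y‖ ^ 2 ≤ (μ₀ - ρ) * α ^ 2 := by rw [hD]; linarith [hE5]
  have hαpos : 0 < α ^ 2 := by
    rcases hα0.eq_or_lt with h0 | h
    · exfalso
      have ht1 : ‖y‖ ^ 2 = 1 := by linarith [hE2]
      have : ρ = Y := by have := hE1; rw [← h0] at this; linarith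
      rw [ht1] at hE5
      linarith
    · exact h
  have hDnn : 0 ≤ μ₀ - ρ := by
    by_contra hneg
    have h' := lt_of_not_ge hneg
    have h0 : 0 ≤ (μ₀ - ρ) * α ^ 2 := le_trans (mul_nonneg hρℓ.le ht0) hG1
    nlinarith [h0, h', hαpos]
  refine ⟨by linarith, ?_⟩
  rw [← sub_le_iff_le_add', le_div_iff₀ hρℓ]
  rcases ht0.eq_or_lt with ht | htpos
  · -- ‖y‖ = 0: then y = 0, Y = 0, α² = 1 and μ₀ = ρ
    have hyz : y = 0 := by
      have h : ‖y‖ = 0 := pow_eq_zero_iff (n := 2) two_ne_zero |>.mp ht.symm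
      exact norm_eq_zero.mp h
    have hY0 : Y = 0 := by
      show ⟪y, A y⟫ = 0
      rw [hyz, inner_zero_left]
    have hα1 : α ^ 2 = 1 := by linarith [hE2]
    have hD0 : μ₀ - ρ = 0 := by
      have h := hD
      rw [hα1, mul_one, ← ht, mul_zero, hY0, sub_zero] at h
      exact h
    rw [hD0, zero_mul]
    positivity
  · -- multiply by ‖y‖² > 0
    have h1 : ‖y‖ ^ 2 * ((μ₀ - ρ) * (ρ - ℓ₁)) ≤ (μ₀ - ρ) ^ 2 * α ^ 2 := by nlinarith [hG1, hDnn]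
    have hE4' : ((μ₀ - ρ) * α ^ 2) ^ 2 ≤ ‖y‖ ^ 2 * R ^ 2 := by rw [hD]; exact hE4
    have key2 : ‖y‖ ^ 2 * r ^ 2 - (μ₀ - ρ) ^ 2 * α ^ 2 = ‖y‖ ^ 2 * R ^ 2 - ((μ₀ - ρ) * α ^ 2) ^ 2 := by
      rw [hE3]
      linear_combination ((μ₀ - ρ) ^ 2 * α ^ 2) * hE2
    have h2 : (μ₀ - ρ) ^ 2 * α ^ 2 ≤ ‖y‖ ^ 2 * r ^ 2 := by linarith [key2, hE4']
    exact le_of_mul_le_mul_left (h1.trans h2) htpos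

/-- **Top-eigenvector perturbation bound** (one-vector Davis–Kahan plus the normalisation step).  In the setting of
`temple_upper`, if the sign of `u₀` is chosen with `⟨u₀, v⟩ ≥ 0`, then `‖u₀ − v‖ ≤ √2 · r/(ρ − ℓ₁)`
(`sin θ = ‖y‖ ≤ r/(ρ − ℓ₁)` and `‖u₀ − v‖² = 2 − 2 cos θ ≤ 2 sin² θ`). [cite: Saad1992, Ch. III Thm 3.9] -/
theorem norm_sub_le_of_residual {u₀ v : E} (hu : ‖u₀‖ = 1) (hv : ‖v‖ = 1) {μ₀ ℓ₁ : ℝ} (hAu : A u₀ = μ₀ • u₀)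
    (hℓ₁ : ∀ y : E, ⟪u₀, y⟫ = 0 → ⟪y, A y⟫ ≤ ℓ₁ * ‖y‖ ^ 2) (hρ : ℓ₁ < ⟪v, A v⟫) (hsign : 0 ≤ ⟪u₀, v⟫) :
    ‖u₀ - v‖ ≤ Real.sqrt 2 * ‖A v - ⟪v, A v⟫ • v‖ / (⟪v, A v⟫ - ℓ₁) := by
  obtain ⟨hE2, hE1, hE3, hE4, hE5⟩ := top_decomp hAs hu hv hAu hℓ₁ hρ rfl rfl
  set ρ := ⟪v, A v⟫
  set α := ⟪u₀, v⟫
  set y := v - α • u₀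
  set Y := ⟪y, A y⟫
  set R := ‖A y - ρ • y‖
  set r := ‖A v - ρ • v‖
  have hρℓ : 0 < ρ - ℓ₁ := sub_pos.mpr hρ
  have ht0 : 0 ≤ ‖y‖ ^ 2 := sq_nonneg _
  -- ‖u₀ − v‖² = 2 − 2α ≤ 2 ‖y‖²
  have hdist : ‖u₀ - v‖ ^ 2 = 2 - 2 * α := by
    rw [norm_sub_sq_real, hu, hv]; ring
  have hα1 : α ≤ 1 := by nlinarith [hE2, ht0]
  have hd2 : ‖u₀ - v‖ ^ 2 ≤ 2 * ‖y‖ ^ 2 := by rw [hdist]; nlinarith [hE2, hsign, hα1]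
  -- ‖y‖² ≤ r²/(ρ − ℓ₁)²
  have hW0 : (ρ - ℓ₁) * ‖y‖ ^ 2 ≤ ρ * ‖y‖ ^ 2 - Y := by linarith [hE5]
  have hR : R ^ 2 ≤ r ^ 2 := by rw [hE3]; nlinarith [sq_nonneg α, sq_nonneg (μ₀ - ρ)]
  have ht : (ρ - ℓ₁) ^ 2 * ‖y‖ ^ 2 ≤ r ^ 2 := by
    rcases ht0.eq_or_lt with h0 | hpos
    · rw [← h0, mul_zero]; positivity
    · have h1 : ((ρ - ℓ₁) * ‖y‖ ^ 2) ^ 2 ≤ ‖y‖ ^ 2 * r ^ 2 := by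
        have h2 : ((ρ - ℓ₁) * ‖y‖ ^ 2) ^ 2 ≤ (ρ * ‖y‖ ^ 2 - Y) ^ 2 :=
          pow_le_pow_left₀ (by positivity) hW0 2
        nlinarith [h2, hE4, hR, ht0]
      have h3 : ‖y‖ ^ 2 * ((ρ - ℓ₁) ^ 2 * ‖y‖ ^ 2) ≤ ‖y‖ ^ 2 * r ^ 2 := by nlinarith [h1]
      exact le_of_mul_le_mul_left h3 hpos
  have hsq : ‖u₀ - v‖ ^ 2 ≤ (Real.sqrt 2 * r / (ρ - ℓ₁)) ^ 2 := by
    rw [div_pow, mul_pow, Real.sq_sqrt (by norm_num : (0 : ℝ) ≤ 2), le_div_iff₀ (by positivity)]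
    nlinarith [hd2, ht]
  have hnn : 0 ≤ Real.sqrt 2 * r / (ρ - ℓ₁) := by positivity
  calc ‖u₀ - v‖ = Real.sqrt (‖u₀ - v‖ ^ 2) := (Real.sqrt_sq (norm_nonneg _)).symm
    _ ≤ Real.sqrt ((Real.sqrt 2 * r / (ρ - ℓ₁)) ^ 2) := Real.sqrt_le_sqrt hsq
    _ = Real.sqrt 2 * r / (ρ - ℓ₁) := Real.sqrt_sq hnn

end TopVector

/-! ### §5 The assembled x2r certificate inequality (TB) and the corrected Rayleigh lower bound (L2) -/

section Assembly

variable {T Q : E →ₗ[ℝ] E} (hTs : ∀ x y : E, ⟪T x, y⟫ = ⟪x, T y⟫) (hpos : ∀ z : E, 0 ≤ ⟪z, T z⟫)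
  (hQs : ∀ x y : E, ⟪Q x, y⟫ = ⟪x, Q y⟫) (hQi : ∀ x : E, Q (Q x) = Q x)
include hTs hpos hQs hQi

/-- **The x2r second-order tail bound (TB), assembled.**  `T ⪰ 0` symmetric (the block `M = S^{1/2} P̂ S^{1/2}`), `Q` the
symmetric idempotent onto the dropped states with `Q T Q ⪯ ε` (`ε ≥ 0`), `T x = λ x` with `x ≠ 0` and `ε < ℓ ≤ λ`
(`ℓ` a certified lower bound of the top eigenvalue), the kept block `⪯ Λ`; `u₀` a unit top eigenvector of the kept block
`(1 − Q) T (1 − Q)` with eigenvalue `μ₀` and the rest of the kept block `⪯ ℓ₁` (`ℓ₁ ≥ 0`); `v` a unit kept vector (the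
float top vector, sign fixed by `⟨u₀, v⟩ ≥ 0`) with Rayleigh quotient `ρ = ⟨v, T v⟩ > ℓ₁`, kept residual
`r = ‖(1 − Q) T v − ρ v‖` and leakage `X^{1/2} = ‖Q T v‖`.  Then with `γ = εΛ/(ℓ − ε)`, `η = √2·r/(ρ − ℓ₁)`:
`λ ≤ μ₀ + c₀ (1 + γ/(μ₀ − ℓ₁ − γ))`, `c₀ = (X^{1/2} + (εΛ)^{1/2} η)²/(ℓ − ε)`, provided `μ₀ − ℓ₁ − γ > 0` — X2R-METHOD.md
(TB) with `Λ = 1` (`x2r_cert.py`: `c0`, `gam`, `eta`, `den`). [cite: HornJohnson2013, Thm 7.7.7] -/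
theorem x2r_upper_bound {ε ℓ lam Λ ℓ₁ μ₀ ρ r X γ η : ℝ} {x u₀ v : E} (hε : 0 ≤ ε)
    (hD : ∀ y : E, ⟪Q y, T (Q y)⟫ ≤ ε * ‖Q y‖ ^ 2) (hx : T x = lam • x) (hx0 : x ≠ 0) (hεℓ : ε < ℓ)
    (hℓ : ℓ ≤ lam) (hΛ : ∀ a : E, Q a = 0 → ⟪a, T a⟫ ≤ Λ * ‖a‖ ^ 2) (hu : ‖u₀‖ = 1) (hQu : Q u₀ = 0)
    (hAu : T u₀ - Q (T u₀) = μ₀ • u₀) (hℓ₁0 : 0 ≤ ℓ₁)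
    (hℓ₁ : ∀ y : E, Q y = 0 → ⟪u₀, y⟫ = 0 → ⟪y, T y⟫ ≤ ℓ₁ * ‖y‖ ^ 2) (hv : ‖v‖ = 1) (hQv : Q v = 0)
    (hsign : 0 ≤ ⟪u₀, v⟫) (hρ : ρ = ⟪v, T v⟫) (hρℓ₁ : ℓ₁ < ρ) (hr : r = ‖T v - Q (T v) - ρ • v‖)
    (hX : X = ‖Q (T v)‖) (hγ : γ = ε * Λ / (ℓ - ε)) (hη : η = Real.sqrt 2 * r / (ρ - ℓ₁))
    (hden : 0 < μ₀ - ℓ₁ - γ) :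
    lam ≤ μ₀ + (X + Real.sqrt (ε * Λ) * η) ^ 2 / (ℓ - ε) * (1 + γ / (μ₀ - ℓ₁ - γ)) := by
  subst hX hη hr hρ
  have hℓε : 0 < ℓ - ε := sub_pos.mpr hεℓ
  have hΛ0 : 0 ≤ Λ := by
    have h1 := hΛ u₀ hQu
    have h2 := hpos u₀
    rw [hu, one_pow, mul_one] at h1
    linarith
  have hγ0 : 0 ≤ γ := by rw [hγ]; positivity
  -- the kept projection P = 1 − Q
  set P : E →ₗ[ℝ] E := LinearMap.id - Q with hPdef
  have hP : ∀ a : E, P a = a - Q a := fun a => rfl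
  have hPs : ∀ x y : E, ⟪P x, y⟫ = ⟪x, P y⟫ := by
    intro x y; rw [hP, hP, inner_sub_left, inner_sub_right, hQs]
  have hQP : ∀ a : E, Q (P a) = 0 := by intro a; rw [hP, map_sub, hQi, sub_self]
  have hPker : ∀ a : E, Q a = 0 → P a = a := by intro a h; rw [hP, h, sub_zero]
  have hPnorm : ∀ a : E, ‖P a‖ ^ 2 ≤ ‖a‖ ^ 2 := fun a => by rw [hP]; exact norm_ker_sq_le hQs hQi a
  -- the kept block A = P T P and the Schur correction C = (ℓ − ε)⁻¹ P T Q T P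
  set A : E →ₗ[ℝ] E := P ∘ₗ T ∘ₗ P with hAdef
  have hAapp : ∀ a : E, A a = P (T (P a)) := fun a => rfl
  have hAs' : ∀ x y : E, ⟪A x, y⟫ = ⟪x, A y⟫ := by
    intro x y; rw [hAapp, hAapp, hPs, hTs, hPs]
  set C : E →ₗ[ℝ] E := (ℓ - ε)⁻¹ • (P ∘ₗ T ∘ₗ Q ∘ₗ T ∘ₗ P) with hCdef
  have hCapp : ∀ a : E, C a = (ℓ - ε)⁻¹ • P (T (Q (T (P a)))) := fun a => rfl
  have hCs' : ∀ x y : E, ⟪C x, y⟫ = ⟪x, C y⟫ := by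
    intro x y; rw [hCapp, hCapp, real_inner_smul_left, real_inner_smul_right, hPs, hTs, hQs, hTs, hPs]
  have hCform : ∀ a : E, ⟪a, C a⟫ = (ℓ - ε)⁻¹ * ‖Q (T (P a))‖ ^ 2 := by
    intro a
    rw [hCapp, real_inner_smul_right, ← hPs a, ← hTs (P a), real_inner_comm (Q (T (P a))) (T (P a)),
      inner_proj_self hQs hQi (T (P a))]
  have hCpos' : ∀ z : E, 0 ≤ ⟪z, C z⟫ := by intro z; rw [hCform]; positivity
  have hoff : ∀ a : E, ‖Q (T (P a))‖ ^ 2 ≤ ε * Λ * ‖a‖ ^ 2 := by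
    intro a
    have h1 := offblock_sq_le hTs hpos hQs hQi hε hD (P a)
    have h2 := hΛ (P a) (hQP a)
    have h3 := hPnorm a
    calc ‖Q (T (P a))‖ ^ 2 ≤ ε * ⟪P a, T (P a)⟫ := h1
      _ ≤ ε * (Λ * ‖P a‖ ^ 2) := mul_le_mul_of_nonneg_left h2 hε
      _ ≤ ε * (Λ * ‖a‖ ^ 2) := mul_le_mul_of_nonneg_left (mul_le_mul_of_nonneg_left h3 hΛ0) hε
      _ = ε * Λ * ‖a‖ ^ 2 := by ring
  have hCγ' : ∀ z : E, ⟪z, C z⟫ ≤ γ * ‖z‖ ^ 2 := by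
    intro z
    rw [hCform, hγ, div_eq_mul_inv]
    have h := mul_le_mul_of_nonneg_left (hoff z) (inv_pos.mpr hℓε).le
    nlinarith [h]
  -- u₀ is the top eigenvector of A, the rest of A is ⪯ ℓ₁
  have hPu : P u₀ = u₀ := hPker u₀ hQu
  have hAu' : A u₀ = μ₀ • u₀ := by rw [hAapp, hPu, hP, hAu]
  have hℓ₁' : ∀ y : E, ⟪u₀, y⟫ = 0 → ⟪y, A y⟫ ≤ ℓ₁ * ‖y‖ ^ 2 := by
    intro y hy
    rw [hAapp, ← hPs]
    have huPy : ⟪u₀, P y⟫ = 0 := by rw [← hPs u₀ y, hPu, hy]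
    have h1 := hℓ₁ (P y) (hQP y) huPy
    nlinarith [h1, hPnorm y, hℓ₁0]
  -- the compression bound on ker Q, and the Schur step
  have hc0 : 0 ≤ ⟪u₀, C u₀⟫ := hCpos' u₀
  have hδ : 0 < μ₀ + ⟪u₀, C u₀⟫ - ℓ₁ - γ := by linarith [hden, hc0]
  have hcomp := compression_bound hAs' hCs' hCpos' hu hAu' hℓ₁' hγ0 hCγ' hδ
  have hUker : ∀ a : E, Q a = 0 →
      ⟪a, T a⟫ + ‖Q (T a)‖ ^ 2 / (ℓ - ε) ≤ (μ₀ + ⟪u₀, C u₀⟫ + ⟪u₀, C u₀⟫ * γ / (μ₀ + ⟪u₀, C u₀⟫ - ℓ₁ - γ)) * ‖a‖ ^ 2 := by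
    intro a ha
    have h := hcomp a
    rw [hAapp, hCform, hPker a ha, ← hPs a, hPker a ha] at h
    rw [div_eq_inv_mul]
    exact h
  have hlamU := le_of_schur_tail hTs hQs hQi hD hx hx0 hεℓ hℓ hUker
  -- c ≤ c₀ : the true top vector u₀ against the float vector v
  have hPv : P v = v := hPker v hQv
  have hAv : A v = T v - Q (T v) := by rw [hAapp, hPv, hP]
  have hvAv : ⟪v, A v⟫ = ⟪v, T v⟫ := by rw [hAapp, hPv, ← hPs v, hPv]
  have hρ' : ℓ₁ < ⟪v, A v⟫ := by rw [hvAv]; exact hρℓ₁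
  have hη' := norm_sub_le_of_residual hAs' hu hv hAu' hℓ₁' hρ' hsign
  rw [hvAv, hAv] at hη'
  have hρℓ : 0 < ⟪v, T v⟫ - ℓ₁ := sub_pos.mpr hρℓ₁
  have hηnn : 0 ≤ Real.sqrt 2 * ‖T v - Q (T v) - ⟪v, T v⟫ • v‖ / (⟪v, T v⟫ - ℓ₁) := by positivity
  have hdiff : ‖Q (T (u₀ - v))‖ ≤ Real.sqrt (ε * Λ) * (Real.sqrt 2 * ‖T v - Q (T v) - ⟪v, T v⟫ • v‖ / (⟪v, T v⟫ - ℓ₁)) := by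
    have h1 : ‖Q (T (u₀ - v))‖ ^ 2 ≤ ε * Λ * ‖u₀ - v‖ ^ 2 := by
      have h := hoff (u₀ - v)
      rwa [hPker (u₀ - v) (by rw [map_sub, hQu, hQv, sub_self])] at h
    have h2 : ‖Q (T (u₀ - v))‖ ≤ Real.sqrt (ε * Λ) * ‖u₀ - v‖ := by
      have h3 : ‖Q (T (u₀ - v))‖ ^ 2 ≤ (Real.sqrt (ε * Λ) * ‖u₀ - v‖) ^ 2 := by
        rw [mul_pow, Real.sq_sqrt (mul_nonneg hε hΛ0)]; exact h1
      calc ‖Q (T (u₀ - v))‖ = Real.sqrt (‖Q (T (u₀ - v))‖ ^ 2) := (Real.sqrt_sq (norm_nonneg _)).symm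
        _ ≤ Real.sqrt ((Real.sqrt (ε * Λ) * ‖u₀ - v‖) ^ 2) := Real.sqrt_le_sqrt h3
        _ = Real.sqrt (ε * Λ) * ‖u₀ - v‖ := Real.sqrt_sq (by positivity)
    exact h2.trans (mul_le_mul_of_nonneg_left hη' (Real.sqrt_nonneg _))
  have hQTu : ‖Q (T u₀)‖ ≤ ‖Q (T v)‖ + Real.sqrt (ε * Λ) * (Real.sqrt 2 * ‖T v - Q (T v) - ⟪v, T v⟫ • v‖ / (⟪v, T v⟫ - ℓ₁)) := by
    have hsplit : Q (T u₀) = Q (T v) + Q (T (u₀ - v)) := by rw [map_sub, map_sub]; abel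
    rw [hsplit]
    exact (norm_add_le _ _).trans (by linarith [hdiff])
  have hcc0 : ⟪u₀, C u₀⟫ ≤ (‖Q (T v)‖ + Real.sqrt (ε * Λ) * (Real.sqrt 2 * ‖T v - Q (T v) - ⟪v, T v⟫ • v‖ / (⟪v, T v⟫ - ℓ₁))) ^ 2 / (ℓ - ε) := by
    rw [hCform, hPu, div_eq_inv_mul]
    have hK := pow_le_pow_left₀ (norm_nonneg _) hQTu 2
    exact mul_le_mul_of_nonneg_left hK (inv_pos.mpr hℓε).le
  -- monotonicity in c and in the denominator
  set c := ⟪u₀, C u₀⟫ with hcdef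
  set c₀ := (‖Q (T v)‖ + Real.sqrt (ε * Λ) * (Real.sqrt 2 * ‖T v - Q (T v) - ⟪v, T v⟫ • v‖ / (⟪v, T v⟫ - ℓ₁))) ^ 2 / (ℓ - ε) with hc₀def
  have hfrac : c * γ / (μ₀ + c - ℓ₁ - γ) ≤ c₀ * γ / (μ₀ - ℓ₁ - γ) := by
    rw [div_le_div_iff₀ (by linarith [hden, hc0]) hden]
    have h1 : c * γ ≤ c₀ * γ := mul_le_mul_of_nonneg_right hcc0 hγ0
    have h2 : 0 ≤ c₀ * γ := mul_nonneg (hc0.trans hcc0) hγ0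
    nlinarith [h1, h2, hc0, hden]
  have hfinal : μ₀ + c + c * γ / (μ₀ + c - ℓ₁ - γ) ≤ μ₀ + c₀ * (1 + γ / (μ₀ - ℓ₁ - γ)) := by
    rw [mul_add, mul_one, mul_div_assoc']
    linarith [hfrac, hcc0]
  exact hlamU.trans hfinal

/-- **The x2r certificate row.**  `x2r_upper_bound` with the exact top `μ₀` of the kept block replaced by a certified
enclosure `μ₀_lo ≤ μ₀ ≤ μ₀_up` (Ostrowski–Weyl / Temple, see `temple_upper`), monotone-safe as in `x2r_cert.py`
(`U_B = mu0_up + c0 (1 + gam/(mu0_lo − l1 − gam))`): `λ ≤ μ₀_up + c₀ (1 + γ/(μ₀_lo − ℓ₁ − γ))`. [cite: Saad1992, Ch. III Thm 3.8] -/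
theorem x2r_upper_bound_of_enclosure {ε ℓ lam Λ ℓ₁ μ₀ μlo μup ρ r X γ η : ℝ} {x u₀ v : E} (hε : 0 ≤ ε)
    (hD : ∀ y : E, ⟪Q y, T (Q y)⟫ ≤ ε * ‖Q y‖ ^ 2) (hx : T x = lam • x) (hx0 : x ≠ 0) (hεℓ : ε < ℓ)
    (hℓ : ℓ ≤ lam) (hΛ : ∀ a : E, Q a = 0 → ⟪a, T a⟫ ≤ Λ * ‖a‖ ^ 2) (hu : ‖u₀‖ = 1) (hQu : Q u₀ = 0)
    (hAu : T u₀ - Q (T u₀) = μ₀ • u₀) (hℓ₁0 : 0 ≤ ℓ₁)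
    (hℓ₁ : ∀ y : E, Q y = 0 → ⟪u₀, y⟫ = 0 → ⟪y, T y⟫ ≤ ℓ₁ * ‖y‖ ^ 2) (hv : ‖v‖ = 1) (hQv : Q v = 0)
    (hsign : 0 ≤ ⟪u₀, v⟫) (hρ : ρ = ⟪v, T v⟫) (hρℓ₁ : ℓ₁ < ρ) (hr : r = ‖T v - Q (T v) - ρ • v‖)
    (hX : X = ‖Q (T v)‖) (hγ : γ = ε * Λ / (ℓ - ε)) (hη : η = Real.sqrt 2 * r / (ρ - ℓ₁))
    (hlo : μlo ≤ μ₀) (hup : μ₀ ≤ μup) (hden : 0 < μlo - ℓ₁ - γ) :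
    lam ≤ μup + (X + Real.sqrt (ε * Λ) * η) ^ 2 / (ℓ - ε) * (1 + γ / (μlo - ℓ₁ - γ)) := by
  have hden0 : 0 < μ₀ - ℓ₁ - γ := by linarith
  have h := x2r_upper_bound hTs hpos hQs hQi hε hD hx hx0 hεℓ hℓ hΛ hu hQu hAu hℓ₁0 hℓ₁ hv hQv hsign hρ hρℓ₁ hr hX hγ hη hden0
  have hℓε : 0 < ℓ - ε := sub_pos.mpr hεℓ
  have hγ0 : 0 ≤ γ := by
    have hΛ0 : 0 ≤ Λ := by
      have h1 := hΛ u₀ hQu; have h2 := hpos u₀; rw [hu, one_pow, mul_one] at h1; linarith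
    rw [hγ]; positivity
  have hc₀ : 0 ≤ (X + Real.sqrt (ε * Λ) * η) ^ 2 / (ℓ - ε) := by positivity
  have hmono : γ / (μ₀ - ℓ₁ - γ) ≤ γ / (μlo - ℓ₁ - γ) :=
    div_le_div_of_nonneg_left hγ0 hden (by linarith)
  nlinarith [h, hmono, hc₀, hup, mul_le_mul_of_nonneg_left hmono hc₀]

omit hQi in
/-- **First-order-corrected Rayleigh lower bound (L2).**  For `T ⪰ 0`, a unit kept vector `v` (`Q v = 0`) and any
dropped correction `z = Q z`: `⟨v + z, T (v + z)⟩ ≥ ⟨v, T v⟩ + 2⟨z, T v⟩` (the block `Q T Q ⪰ 0` is dropped) and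
`‖v + z‖² = 1 + ‖z‖²`, so every upper form bound `Λ₀` of `T` (`= λ_max`) satisfies
`(⟨v, T v⟩ + 2⟨z, T v⟩)/(1 + ‖z‖²) ≤ Λ₀` — x2r's lower endpoint with `z = Q T v/ρ̂` (`2⟨z, T v⟩ = 2X/ρ̂`, `‖z‖² = X/ρ̂²`). [folklore] -/
theorem rayleigh_corrected_lower {v z : E} (hv : ‖v‖ = 1) (hQv : Q v = 0) (hz : Q z = z) {Λ₀ : ℝ}
    (hmax : ∀ w : E, ⟪w, T w⟫ ≤ Λ₀ * ‖w‖ ^ 2) :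
    (⟪v, T v⟫ + 2 * ⟪z, T v⟫) / (1 + ‖z‖ ^ 2) ≤ Λ₀ := by
  have hvz : ⟪v, z⟫ = 0 := by rw [← hz, ← hQs, hQv, inner_zero_left]
  have hn : ‖v + z‖ ^ 2 = 1 + ‖z‖ ^ 2 := by rw [norm_add_sq_real, hvz, hv]; ring
  have h := hmax (v + z)
  rw [hn, map_add, inner_add_left, inner_add_right, inner_add_right, ← hTs z v, real_inner_comm (T z) v,
    hTs z v] at h
  have hzz : 0 ≤ ⟪z, T z⟫ := hpos z
  rw [div_le_iff₀ (by positivity)]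
  linarith

end Assembly

end SecondOrderTail

end Summit.Ventures.YMGap.FlowData
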